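import Mathlib.Topology.Algebra.ValuativeRel.ValuativeTopology
import Literature.AnabelianGeometry.AbsoluteAnabelian.AbsTopIII.KummerFaithfulLocalFieldProofs
import Literature.NumberTheory.GaloisRepresentations.PadicAlgClFiniteSubextensionDvr
import HarnessLib

/-!
# [AbsTopIII] §3: compactness of the unit group of an MLF and compatible systems of powers

Proof-only companion (theorems only, no new definitions) in the lane of `MonoidKummerMaps.lean`
(seat abc-iut-L4-t2; S. Mochizuki, *Topics in Absolute Anabelian Geometry III*, Prop. 3.3 (ii)
p. 74 "a bijection if `T = TCG`", and [IUTchII] Rmk. 1.11.1 (i)(b) "the [`G`-linear]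
automorphisms of `𝒪^×(G)` determined by the natural action of `Ẑ^×`"; kurims manuscripts, lit keys
`paper:url-5493eb38cbb7`, `paper:url-5036b4059555`).  The `Ẑ^×`-action `x ↦ x^u` on `𝒪_k̄^×` is
"not in the tree" (review of p409065, `GaloisPairRigidity.lean`: the datum `zhatPow`); this file
supplies its analytic core IN THEOREM FORM, without limits: for a non-archimedean local field `L`,
a unit `x ∈ 𝒪_L^×` and a compatible system of exponents `e_j (mod N_j)`, `N_j ∣ N_{j+1}`, there is a
unit `y` with `y ∈ x^{e_j} · (𝒪_L^×)^{N_j}` for EVERY `j` — by compactness of `𝒪_L^× = {v = 1}`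
(Mathlib `IsNonarchimedeanLocalField.isCompact_closedBall`) and Cantor's intersection theorem.

* `isCompact_sphere_one`, `t2Space_of_isNonarchimedeanLocalField` — `{x | v x = 1}` is compact;
  an MLF is Hausdorff;
* `exists_mem_iInter_pow_cosets` — the Cantor-intersection statement above;
* `MLFClosure.mem_unitSubmonoid_iff_valuation_eq_one` — for the model data `(k, k̄)` of
  [AbsTopIII] §3 (`MLFClosure`) and a finite level `k ⊆ k' ⊆ k̄` with its local-field structure
  (tree `FiniteExtension.*`): `x ∈ 𝒪_k̄^×` iff `v_{k'}(x) = 1` (spectral norm = integral closure,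
  tree `spectralNorm_le_one_iff_isIntegral`);
* `MLFClosure.exists_unit_compatible_pow` — for `x ∈ 𝒪_k̄^×` in a finite level `k'` and a
  compatible exponent system `a : ℕ → ℕ` (`a n ≡ a m (mod m)` for `m ∣ n`): there is `y ∈ k'`,
  `y ∈ 𝒪_k̄^×`, with `y = x^{a n} · w^n`, `w ∈ k'^×`, for every `n ≥ 1` — the value "`x^a`" for
  `a ∈ Ẑ`, characterised algebraically (its uniqueness is `⋂_n (k'^×)^n = 1`,
  `KummerFaithfulLocalFieldProofs`).

HONEST FRAMING: classical local-field facts (compactness of the unit group); OUR kernel check;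
nothing here bears on [IUTchIII] Cor. 3.12.
-/

noncomputable section

namespace Literature.AnabelianGeometry.AbsoluteAnabelian

open _root_.ValuativeRel
open Literature.NumberTheory.GaloisRepresentations

universe u

/-! ### The unit sphere of a non-archimedean local field -/

section LocalField

variable (L : Type*) [Field L] [ValuativeRel L] [TopologicalSpace L] [IsNonarchimedeanLocalField L]

/-- A non-archimedean local field is Hausdorff (a non-zero `x` is separated from `0` by the ball
`{v < v x}`). [cite: MochizukiAbsTopIII2015, Remark 3.1.1 p.70] -/
theorem t2Space_of_isNonarchimedeanLocalField : T2Space L := by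
  apply IsTopologicalAddGroup.t2Space_of_zero_sep
  intro x hx
  have hvx : valuation L x ≠ 0 := fun h => hx ((map_eq_zero _).mp h)
  refine ⟨{z | valuation L z < valuation L x}, ?_, fun h => lt_irrefl (valuation L x) h⟩
  rw [IsValuativeTopology.mem_nhds_iff]
  refine ⟨Units.mk0 _ hvx, ?_⟩
  rintro _ ⟨z, hz, rfl⟩
  simpa using hz

/-- The unit sphere `{x | v x = 1} = 𝒪_L^×` of a non-archimedean local field is compact (closed in the
compact unit ball; it is open and closed since the valuation is locally constant off `0`).
[cite: MochizukiAbsTopIII2015, Remark 3.1.1 p.70] -/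
theorem isCompact_sphere_one : IsCompact {x : L | valuation L x = 1} := by
  have hcl : IsClosed {x : L | valuation L x = 1} := by
    rw [← isOpen_compl_iff, isOpen_iff_mem_nhds]
    intro x hx
    simp only [Set.mem_compl_iff, Set.mem_setOf_eq] at hx
    by_cases h0 : valuation L x = 0
    · have hx0 : x = 0 := (map_eq_zero _).mp h0
      subst hx0
      rw [IsValuativeTopology.mem_nhds_iff]
      refine ⟨1, ?_⟩
      rintro _ ⟨z, hz, rfl⟩
      simp only [Set.mem_setOf_eq, zero_add, Set.mem_compl_iff] at hz ⊢
      exact ne_of_lt (by simpa using hz)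
    · have h := Valuation.locally_const (v := valuation L) (x := x) h0
      exact Filter.mem_of_superset h (fun y hy => by
        simp only [Set.mem_setOf_eq, Set.mem_compl_iff] at hy ⊢
        rw [hy]; exact hx)
  exact (IsNonarchimedeanLocalField.isCompact_closedBall L 1).of_isClosed_subset hcl
    (fun x hx => by simp only [Set.mem_setOf_eq] at hx ⊢; exact hx.le)

/-- **Cantor-intersection form of "`x^u`, `u ∈ Ẑ`".**  Let `x` be a unit of the non-archimedean
local field `L`, `N : ℕ → ℕ` with `N j ∣ N (j+1)`, and `e : ℕ → ℤ` exponents with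
`e (j+1) ≡ e j (mod N j)`.  Then some unit `y` lies in `x ^ e j · (𝒪_L^×)^{N j}` for EVERY `j`: the
sets `x ^ e j · (𝒪_L^×)^{N j}` are nonempty, nested, compact (continuous images of the compact unit
group) and closed (Hausdorff), so their intersection is nonempty.
[cite: MochizukiAbsTopIII2015, Proposition 3.3 (ii) p.74] -/
theorem exists_mem_iInter_pow_cosets {x : L} (hx : valuation L x = 1) (N : ℕ → ℕ) (e : ℕ → ℤ)
    (hdvd : ∀ j, N j ∣ N (j + 1)) (he : ∀ j, (N j : ℤ) ∣ e (j + 1) - e j) :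
    ∃ y : L, valuation L y = 1 ∧
      ∀ j, ∃ w : L, valuation L w = 1 ∧ y = x ^ e j * w ^ N j := by
  classical
  haveI : T2Space L := t2Space_of_isNonarchimedeanLocalField L
  have hx0 : x ≠ 0 := fun h => by rw [h, map_zero] at hx; exact zero_ne_one hx
  set S : Set L := {z : L | valuation L z = 1} with hS
  have hSc : IsCompact S := isCompact_sphere_one L
  -- the nested family of cosets
  set t : ℕ → Set L := fun j => (fun w : L => x ^ e j * w ^ N j) '' S with ht
  have hcont : ∀ j, Continuous fun w : L => x ^ e j * w ^ N j := fun j => by fun_prop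
  have htc : ∀ j, IsCompact (t j) := fun j => hSc.image (hcont j)
  have htcl : ∀ j, IsClosed (t j) := fun j => (htc j).isClosed
  have htn : ∀ j, (t j).Nonempty := fun j => ⟨_, ⟨1, by simp [hS], rfl⟩⟩
  have htd : ∀ j, t (j + 1) ⊆ t j := by
    intro j
    rintro _ ⟨w, hw, rfl⟩
    obtain ⟨m, hm⟩ := hdvd j
    obtain ⟨s, hs⟩ := he j
    -- `x ^ e (j+1) * w ^ N (j+1) = x ^ e j * (x ^ s * w ^ m) ^ N j`
    refine ⟨x ^ s * w ^ m, ?_, ?_⟩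
    · simp only [hS, Set.mem_setOf_eq, map_mul, map_zpow₀, map_pow, hx, one_zpow, one_mul]
      simp only [hS, Set.mem_setOf_eq] at hw
      rw [hw, one_pow]
    · have hes : e (j + 1) = e j + N j * s := by linarith
      show x ^ e j * (x ^ s * w ^ m) ^ N j = x ^ e (j + 1) * w ^ N (j + 1)
      rw [hes, hm, mul_pow, ← pow_mul, zpow_add₀ hx0, mul_comm (N j : ℤ) s, zpow_mul, zpow_natCast]
      ring
  obtain ⟨y, hy⟩ := IsCompact.nonempty_iInter_of_sequence_nonempty_isCompact_isClosed t htd htn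
    (htc 0) htcl
  rw [Set.mem_iInter] at hy
  refine ⟨y, ?_, fun j => ?_⟩
  · obtain ⟨w, hw, hwy⟩ := hy 0
    simp only [hS, Set.mem_setOf_eq] at hw
    rw [← hwy]
    simp [map_mul, map_zpow₀, map_pow, hx, hw]
  · obtain ⟨w, hw, hwy⟩ := hy j
    exact ⟨w, hw, hwy.symm⟩

end LocalField

/-! ### The finite levels of the model data `(k, k̄)` of [AbsTopIII] §3 -/

section Model

variable (C : MLFClosure.{u}) (k' : IntermediateField C.k C.K) [FiniteDimensional C.k k']

/-- For a finite level `k ⊆ k' ⊆ k̄` of the model data, with the local-field structure of the tree's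
`FiniteExtension` (spectral norm), an element `x ∈ k'` lies in `𝒪_k̄^×` (`unitSubmonoid`: integral
over `𝒪_k` together with its inverse) iff its valuation is `1` — spectral norm `≤ 1` ⇔ integral over
`𝒪_k` (tree `spectralNorm_le_one_iff_isIntegral`) applied to `x` and `x⁻¹`.
[cite: MochizukiAbsTopIII2015, Definition 3.1 (i) p.66] -/
theorem MLFClosure.mem_unitSubmonoid_iff_valuation_eq_one (x : k') :
    (x : C.K) ∈ unitSubmonoid C.k C.K ↔
      (letI := FiniteExtension.valuativeRel C.k k'; valuation k' x = 1) := by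
  letI := FiniteExtension.normedField C.k k'
  letI := FiniteExtension.valuativeRel C.k k'
  haveI : IsNonarchimedeanLocalField k' := FiniteExtension.isNonarchimedeanLocalField C.k k'
  haveI := FiniteExtension.compatible C.k k'
  letI := Literature.NumberTheory.GaloisRepresentations.IsNonarchimedeanLocalField.nontriviallyNormedField C.k
  -- norm on the base: unit ball = `𝒪_k`
  have hR : ∀ z : C.k, ‖z‖ ≤ 1 ↔ z ∈ (algebraMap 𝒪[C.k] C.k).range := by
    intro z
    rw [Literature.NumberTheory.GaloisRepresentations.IsNonarchimedeanLocalField.norm_le_one_iff]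
    constructor
    · intro hz; exact ⟨⟨z, hz⟩, rfl⟩
    · rintro ⟨w, rfl⟩; exact w.2
  -- spectral norm `≤ 1` iff integral over `𝒪_k`
  have hint : ∀ y : k', ‖y‖ ≤ 1 ↔ (y : C.K) ∈ integersClosure C.k C.K := by
    intro y
    rw [integersClosure, mem_integralClosure_iff, FiniteExtension.norm_def,
      spectralNorm_le_one_iff_isIntegral hR (Algebra.IsIntegral.isIntegral y)]
    exact (isIntegral_algHom_iff ((k'.val).restrictScalars 𝒪[C.k]) Subtype.val_injective).symm
  -- valuation vs norm on `k'`
  have hvn : ∀ y z : k', valuation k' y ≤ valuation k' z ↔ ‖y‖ ≤ ‖z‖ := by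
    intro y z
    rw [← Valuation.Compatible.vle_iff_le, FiniteExtension.vle_iff_norm_le]
  have hv1 : valuation k' x = 1 ↔ ‖x‖ = 1 := by
    constructor
    · intro h
      apply le_antisymm
      · simpa using (hvn x 1).mp (by rw [h, map_one])
      · simpa using (hvn 1 x).mp (by rw [h, map_one])
    · intro h
      apply le_antisymm
      · simpa using (hvn x 1).mpr (by rw [h, norm_one])
      · simpa using (hvn 1 x).mpr (by rw [h, norm_one])
  rw [hv1]
  constructor
  · rintro ⟨hxint, y, hyint, hxy⟩
    have hx0 : (x : C.K) ≠ 0 := left_ne_zero_of_mul_eq_one hxy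
    have hx0' : x ≠ 0 := fun h => hx0 (by rw [h]; rfl)
    have hyinv : y = ((x⁻¹ : k') : C.K) := by
      rw [eq_inv_of_mul_eq_one_right hxy]; push_cast; rfl
    have h1 : ‖x‖ ≤ 1 := (hint x).mpr hxint
    have h2 : ‖x⁻¹‖ ≤ 1 := (hint x⁻¹).mpr (hyinv ▸ hyint)
    rw [norm_inv] at h2
    have hpos : 0 < ‖x‖ := norm_pos_iff.mpr hx0'
    have h3 : 1 ≤ ‖x‖ := by
      have := mul_le_mul_of_nonneg_left h2 hpos.le
      rw [mul_inv_cancel₀ hpos.ne', mul_one] at this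
      exact this
    exact le_antisymm h1 h3
  · intro h
    have hx0' : x ≠ 0 := fun h0 => by rw [h0, norm_zero] at h; exact zero_ne_one h
    refine ⟨(hint x).mp h.le, ((x⁻¹ : k') : C.K), (hint x⁻¹).mp (by rw [norm_inv, h, inv_one]), ?_⟩
    push_cast
    exact mul_inv_cancel₀ (fun h0 => hx0' (by exact_mod_cast h0))

/-- **Compatible powers of a unit at a finite level.**  For the model data `(k, k̄)`, a finite level
`k'`, a unit `x ∈ 𝒪_k̄^× ∩ k'` and a compatible exponent system `a : ℕ → ℕ`
(`a n ≡ a m (mod m)` whenever `m ∣ n`): there is `y ∈ 𝒪_k̄^× ∩ k'` such that for every `n ≥ 1`,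
`y = x^{a n} · w^n` for some nonzero `w ∈ k'` — "`y = x^a`, `a = (a_n)_n ∈ Ẑ`", the `Ẑ`-exponentiation
on `𝒪_k̄^×` of [IUTchII] Rmk. 1.11.1 (i)(b) / [AbsTopIII] Prop. 3.3 (ii) `TCG`, characterised
algebraically (unique by `⋂_n (k'^×)^n = 1`, `MLFClosure.eq_one_of_forall_pos_exists_pow_eq`).
[cite: MochizukiAbsTopIII2015, Proposition 3.3 (ii) p.74] -/
theorem MLFClosure.exists_unit_compatible_pow (x : k') (hx : (x : C.K) ∈ unitSubmonoid C.k C.K)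
    (a : ℕ → ℕ) (ha : ∀ m n : ℕ, 0 < m → m ∣ n → a n ≡ a m [MOD m]) :
    ∃ y : k', (y : C.K) ∈ unitSubmonoid C.k C.K ∧
      ∀ n : ℕ, 0 < n → ∃ w : k', w ≠ 0 ∧ y = x ^ a n * w ^ n := by
  classical
  letI := FiniteExtension.normedField C.k k'
  letI := FiniteExtension.valuativeRel C.k k'
  haveI : IsNonarchimedeanLocalField k' := FiniteExtension.isNonarchimedeanLocalField C.k k'
  have hxv : valuation k' x = 1 := (C.mem_unitSubmonoid_iff_valuation_eq_one k' x).mp hx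
  have hx0 : x ≠ 0 := fun h => by rw [h, map_zero] at hxv; exact zero_ne_one hxv
  -- the factorial tower `N j = (j+1)!`, exponents `e j = a (N j)`
  obtain ⟨y, hyv, hy⟩ := exists_mem_iInter_pow_cosets k' hxv (fun j => (j + 1).factorial)
    (fun j => (a (j + 1).factorial : ℤ))
    (fun j => Nat.factorial_dvd_factorial (Nat.le_succ _))
    (fun j => (Nat.modEq_iff_dvd.mp (ha _ _ (Nat.factorial_pos _)
      (Nat.factorial_dvd_factorial (Nat.le_succ _))).symm))
  refine ⟨y, (C.mem_unitSubmonoid_iff_valuation_eq_one k' y).mpr hyv, fun n hn => ?_⟩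
  -- read off the coset at the level `j = n - 1`, `N j = n!`
  obtain ⟨w, hwv, hyw⟩ := hy (n - 1)
  have hN : (n - 1 + 1).factorial = n * (n - 1).factorial := by
    rw [Nat.sub_add_cancel hn]
    exact (Nat.mul_factorial_pred hn.ne').symm
  have hw0 : w ≠ 0 := fun h => by rw [h, map_zero] at hwv; exact zero_ne_one hwv
  -- `a (n!) = a n + n t`
  have hmod : a ((n - 1 + 1).factorial) ≡ a n [MOD n] :=
    ha n _ hn (by rw [Nat.sub_add_cancel hn]; exact Nat.dvd_factorial hn le_rfl)
  obtain ⟨t, ht⟩ := (Nat.modEq_iff_dvd.mp hmod.symm)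
  -- ht : a (n!) - a n = n * t  (as integers)
  refine ⟨x ^ t * w ^ (n - 1).factorial, mul_ne_zero (zpow_ne_zero _ hx0) (pow_ne_zero _ hw0), ?_⟩
  rw [hyw, hN, mul_pow, ← pow_mul, mul_comm ((n - 1).factorial) n, ← mul_assoc]
  congr 1
  simp only [← zpow_natCast]
  rw [← zpow_mul, ← zpow_add₀ hx0]
  congr 1
  rw [hN] at ht
  linarith

end Model

end Literature.AnabelianGeometry.AbsoluteAnabelian

end
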